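import Literature.MathematicalPhysics.QuantumFieldTheory.Balaban1983to89.B7Prop3GeneralTildRec
import Literature.MathematicalPhysics.QuantumFieldTheory.Balaban1983to89.B7Prop3FlatRecSide
import Literature.MathematicalPhysics.QuantumFieldTheory.Balaban1983to89.B7Prop3GeneralAnalytic

/-!
# `Balaban1983to89.B7Prop3GeneralAnalyticRec` — [Balaban1985Averaging] PROPOSITION 3 AT A GENERAL BACKGROUND, THE ANALYTICITY CLAUSE (121) AND THE DOMAIN CONDITIONS (120) pp. 35–36 — FOR THE
# RECORD's AVERAGING STRUCTURE ([Balaban1987RG1] (0.3)–(0.4)): `Q(V₀, A, c) = (1/i) log V̿₁(c)` is analytic in `A` for `|A_b| ≤ c₃(d,L)` at an `α`-regular unit-bounded background, for the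
# record twins — every (0.4) loop `W_i` of length `2|x − y|₁ + 2L ≤ (2d+2)L` is within `1/16` of `1`, the frames within `1/8`, `|V̿₁(c) − 1| ≤ 4/5`, `|log V̿₁(c)| ≤ 4`

statement-level skeleton of published theorems with citation tags; proofs where landed; nothing here is a claim about the Yang–Mills mass gap

CITATION HEADER (lean-in-tree rule).  Cell `pub-ymgap`, seat `pub-ymgap-dag-n05-e` g35 (N05-REC LEAD PEN); item R1 ([3] layer) — file 3 of the Prop. 3 general-background chain for the record.
`--kind proof --supports stmt-QuantumFields-20541` (K0⁷; count-neutral; no definition).  Sources READ: [3] pp. 34–36 (`paper:balaban1985-cmp98-averaging`), [Balaban1987RG1] (0.3)–(0.4) pp. 252–254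
(`paper:balaban1987-cmp109-rg-i-small-field`), through the engine module `B7Prop3GeneralAnalytic`, re-run over the record objects (TOKEN RULE (T1)–(T3): `Wcx … (boxVec r) ↦ WZ … i`, `i : IdxZ d L`,
weights `|IdxZ|⁻¹` (`B7Prop3FlatRecSide.norm_avgZ_le`), `Xavg ∕ bavg ∕ tild ∕ dbavgCov ∕ Fcov ∕ wframe ↦ …Z`, frame words `treeWord (offZ L r)`; the ONE place the modification is more than a token:
the loop-length bookkeeping — NODE 00's `loopWord` has length `2‖offZ r‖₁ + 2L ≤ (2d+2)L` (`length_loopWord`, `l1_offZ_le_dL`), the SAME bound the engine's `Γ_{c,x} ∪ (−c)` obeys, so print's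
threshold `c₃ = 1∕(128(d+1)L)` is unchanged — [I] p. 254: «only minor and obvious modifications are needed»).  The bond∕step∕contour analyticity (`analyticAt_hol_mulCfg`, `analyticAt_tHol_expCfg`) and
the twisted-holonomy estimates (`norm_tHol_expCfg_sub_one_le(_of_length)`) are REUSED BY NAME from the engine.
WHAT IS PROVED (sorry-free): §1 `analyticAt_FcovZ_expCfg`, `analyticAt_wframeZ_expCfg`, ★`analyticAt_XZ_mulCfg`, `analyticAt_bavgZ_mulCfg`, `analyticAt_tildZ_expCfg`, `analyticAt_dbavgCovZ_expCfg`, ★`analyticAt_mlog_dbavgCovZ_expCfg`;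
§2 `norm_XZ_le_of_WZ`, `norm_FcovZ_le_of_tHol`, `WZ_mul_eq_tHol_mul`, `tildZ_eq_exp_tHol_exp`, ★★`logDomainCovZ` (THE DOMAIN CONDITIONS for the record: loops `≤ 1/16`, frames `≤ 1/32`, `|V̿₁(c) − 1| ≤ 4/5`),
`logDomainCovZ_lt`, ★`norm_mlog_dbavgCovZ_le` (`|Q| ≤ 4`); §3 ★★`prop3Z_general_analyticAt`, `prop3Z_general_analyticAt_of_le_c3` (PROP. 3 (121) for the record at `|A_b| ≤ c₃(d,L)`).
HONEST SCOPE.  Analyticity and elementary domain estimates for OUR typed record objects at print's thresholds; `HThm4Rec` UNDISCHARGED; N05 ∕ N07 NOT discharged; counts unmoved (typed 28∕28 ·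
discharged 7∕28); one finite 𝕋⁴ programme at fixed ε — nothing continuum ∕ ℝ⁴ ∕ OS ∕ mass gap ∕ Clay.  No `def`, no `instance`, no `notation`, no `sorry`.
-/

set_option autoImplicit false

noncomputable section

open scoped BigOperators
open NormedSpace Finset

namespace Literature.MathematicalPhysics.QuantumFieldTheory.Balaban1983to89.B7Prop3GeneralAnalyticRec

open B7Prop1Explicit hiding Site
open B7Prop1Explicit renaming Site → SiteZ
open MatrixLog B7AvgGaugeCovariance B7Prop3GeneralRotated
open B7Prop3Flat (expCfg c3)
open B7Prop3GeneralAnalytic (analyticAt_hol_mulCfg analyticAt_tHol_expCfg tHol_cons norm_tHol_expCfg_sub_one_le norm_tHol_expCfg_sub_one_le_of_length)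
open B7Eq92Concrete (Rc Rc_apply Rc_mul Rc_inv_apply Rc_one_apply mgauge tHol tHol_nil mlog_Rc expUnit_conj)
open B7Eq78Linearization (conjR conjR_apply)
open BlockAveragingZd (offZ IdxZ WZ WZ_def XZ bavgZ bavgZ_apply avgIterZ length_loopWord)
open B7SectCDGaugeAveragesRec (FcovZ wframeZ tildZ dbavgCovZ)
open B7SectEFLinearisationRec (FhatCovZ QcovZ linQcovZ CcovZ)
open B7Eq92ConcreteRec (tildZ_apply dbavgCovZ_apply)
open B7Prop3FlatRecSide (l1_offZ_le_dL norm_avgZ_le)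
open T4Continuum (loopWord)

variable {d : ℕ}

/-! ## §1 Analyticity of the record's block functions of `V₁ = e^{B(t)}` at a general background -/

section Analytic

variable {𝔸 : Type*} [NormedRing 𝔸] [NormedAlgebra ℂ 𝔸] [CompleteSpace 𝔸]
variable {E : Type*} [NormedAddCommGroup E] [NormedSpace ℂ E]

/-- The frame exponent `F(y) = Σ_{x∈B(y)} L^{−d} log (R_{0,y}V₁)(Γ_{y,x})` (62)/(82) of `V₁ = e^{B(t)}` is analytic in `t`
wherever every twisted tree holonomy lies in the domain `|W − 1| < 1` of the series logarithm (21).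
[cite: Balaban1985Averaging, (62) p.28, (82) p.30] -/
theorem analyticAt_FcovZ_expCfg (B : E → SiteZ d → Fin d → 𝔸) {t₀ : E}
    (hB : ∀ x κ, AnalyticAt ℂ (fun t => B t x κ) t₀) (L : ℕ) (V₀ : SiteZ d → Fin d → 𝔸ˣ) (y : SiteZ d)
    (hT : ∀ r : Fin d → Fin L,
      ‖((tHol V₀ (expCfg (B t₀)) y (treeWord (offZ L r)) : 𝔸ˣ) : 𝔸) - 1‖ < 1) :
    AnalyticAt ℂ (fun t => FcovZ L V₀ (expCfg (B t)) y) t₀ := by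
  unfold FcovZ
  exact Finset.analyticAt_fun_sum _ fun r _ =>
    ((ExpMeanLog.analyticAt_mlog (hT r)).fun_comp_of_eq (analyticAt_tHol_expCfg B hB V₀ y _).1 rfl).fun_const_smul

/-- The block frame `\overline{R_{0,y}V₁} = e^{F(y)}` (82) of `V₁ = e^{B(t)}` and its inverse are analytic in `t` (same
domain condition). [cite: Balaban1985Averaging, (82) p.30, (62) p.28] -/
theorem analyticAt_wframeZ_expCfg (B : E → SiteZ d → Fin d → 𝔸) {t₀ : E}
    (hB : ∀ x κ, AnalyticAt ℂ (fun t => B t x κ) t₀) (L : ℕ) (V₀ : SiteZ d → Fin d → 𝔸ˣ) (y : SiteZ d)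
    (hT : ∀ r : Fin d → Fin L,
      ‖((tHol V₀ (expCfg (B t₀)) y (treeWord (offZ L r)) : 𝔸ˣ) : 𝔸) - 1‖ < 1) :
    AnalyticAt ℂ (fun t => ((wframeZ L V₀ (expCfg (B t)) y : 𝔸ˣ) : 𝔸)) t₀ ∧
      AnalyticAt ℂ (fun t => (((wframeZ L V₀ (expCfg (B t)) y)⁻¹ : 𝔸ˣ) : 𝔸)) t₀ := by
  refine ⟨?_, ?_⟩
  · simp only [wframeZ, val_expUnit]
    exact (exp_analytic _).fun_comp_of_eq (analyticAt_FcovZ_expCfg B hB L V₀ y hT) rfl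
  · simp only [wframeZ, val_inv_expUnit]
    exact (exp_analytic _).fun_comp_of_eq (analyticAt_FcovZ_expCfg B hB L V₀ y hT).neg rfl

/-- The exponent `X_c` of the one-step average (42) of the product `V₁V₀`, `V₁ = e^{B(t)}`, is analytic in `t` wherever
every `(V₁V₀)(Γ_{c,x})(V₁V₀)(c)⁻¹` lies in `|W − 1| < 1`. [cite: Balaban1985Averaging, (42) p.23] -/
theorem analyticAt_XZ_mulCfg (B : E → SiteZ d → Fin d → 𝔸) {t₀ : E}
    (hB : ∀ x κ, AnalyticAt ℂ (fun t => B t x κ) t₀) (L : ℕ) (V₀ : SiteZ d → Fin d → 𝔸ˣ) (q : SiteZ d) (κ : Fin d)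
    (hW : ∀ i : IdxZ d L, ‖((WZ L (expCfg (B t₀) * V₀) q κ i : 𝔸ˣ) : 𝔸) - 1‖ < 1) :
    AnalyticAt ℂ (fun t => XZ L (expCfg (B t) * V₀) q κ) t₀ := by
  unfold XZ
  refine Finset.analyticAt_fun_sum _ fun i _ => ?_
  have h := (analyticAt_hol_mulCfg B hB V₀ (loopWord L κ (offZ L i.1) i.2.1 i.2.2) q).1
  simp only [← WZ_def] at h
  exact ((ExpMeanLog.analyticAt_mlog (hW i)).fun_comp_of_eq h rfl).fun_const_smul

/-- The one-step average (42) `(\overline{V₁V₀})(c) = e^{X_c}·(V₁V₀)(c)` of the product, `V₁ = e^{B(t)}`, is analytic in `t`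
(same domain condition). [cite: Balaban1985Averaging, (42) p.23, (65) p.29] -/
theorem analyticAt_bavgZ_mulCfg (B : E → SiteZ d → Fin d → 𝔸) {t₀ : E}
    (hB : ∀ x κ, AnalyticAt ℂ (fun t => B t x κ) t₀) (L : ℕ) (V₀ : SiteZ d → Fin d → 𝔸ˣ) (q : SiteZ d) (κ : Fin d)
    (hW : ∀ i : IdxZ d L, ‖((WZ L (expCfg (B t₀) * V₀) q κ i : 𝔸ˣ) : 𝔸) - 1‖ < 1) :
    AnalyticAt ℂ (fun t => ((bavgZ L (expCfg (B t) * V₀) q κ : 𝔸ˣ) : 𝔸)) t₀ := by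
  simp only [bavgZ_apply, Units.val_mul, val_expUnit]
  exact ((exp_analytic _).fun_comp_of_eq (analyticAt_XZ_mulCfg B hB L V₀ q κ hW) rfl).fun_mul
    (analyticAt_hol_mulCfg B hB V₀ _ q).1

/-- **(65)** `Ṽ₁(c) = (\overline{V₁V₀})(c)·(V̄₀)(c)⁻¹`, `V₁ = e^{B(t)}`, is analytic in `t` (same domain condition; the
second factor does not depend on `t`). [cite: Balaban1985Averaging, (65) p.29] -/
theorem analyticAt_tildZ_expCfg (B : E → SiteZ d → Fin d → 𝔸) {t₀ : E}
    (hB : ∀ x κ, AnalyticAt ℂ (fun t => B t x κ) t₀) (L : ℕ) (V₀ : SiteZ d → Fin d → 𝔸ˣ) (q : SiteZ d) (κ : Fin d)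
    (hW : ∀ i : IdxZ d L, ‖((WZ L (expCfg (B t₀) * V₀) q κ i : 𝔸ˣ) : 𝔸) - 1‖ < 1) :
    AnalyticAt ℂ (fun t => ((tildZ L V₀ (expCfg (B t)) q κ : 𝔸ˣ) : 𝔸)) t₀ := by
  simp only [tildZ_apply, Units.val_mul]
  exact (analyticAt_bavgZ_mulCfg B hB L V₀ q κ hW).fun_mul analyticAt_const

/-- **(89)** the double-bar average `V̿₁(c) = (\overline{R_{0,c₋}V₁})⁻¹ Ṽ₁(c) R̄_{0,c}\overline{R_{0,c₊}V₁}` of `V₁ = e^{B(t)}`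
at the background `V₀` is analytic in `t` wherever the contour words entering `X_c`, `F(c₋)`, `F(c₊)` lie in the domain of
the series logarithm (21). [cite: Balaban1985Averaging, (89) p.31, (120) p.35] -/
theorem analyticAt_dbavgCovZ_expCfg (B : E → SiteZ d → Fin d → 𝔸) {t₀ : E}
    (hB : ∀ x κ, AnalyticAt ℂ (fun t => B t x κ) t₀) (L : ℕ) (V₀ : SiteZ d → Fin d → 𝔸ˣ) (q : SiteZ d) (κ : Fin d)
    (hW : ∀ i : IdxZ d L, ‖((WZ L (expCfg (B t₀) * V₀) q κ i : 𝔸ˣ) : 𝔸) - 1‖ < 1)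
    (hT₁ : ∀ r : Fin d → Fin L,
      ‖((tHol V₀ (expCfg (B t₀)) q (treeWord (offZ L r)) : 𝔸ˣ) : 𝔸) - 1‖ < 1)
    (hT₂ : ∀ r : Fin d → Fin L,
      ‖((tHol V₀ (expCfg (B t₀)) (q + (L : ℤ) • e κ) (treeWord (offZ L r)) : 𝔸ˣ) : 𝔸) - 1‖ < 1) :
    AnalyticAt ℂ (fun t => ((dbavgCovZ L V₀ (expCfg (B t)) q κ : 𝔸ˣ) : 𝔸)) t₀ := by
  simp only [dbavgCovZ_apply, Rc_apply, Units.val_mul]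
  exact (((analyticAt_wframeZ_expCfg B hB L V₀ q hT₁).2.fun_mul (analyticAt_tildZ_expCfg B hB L V₀ q κ hW)).fun_mul
    ((analyticAt_const.fun_mul (analyticAt_wframeZ_expCfg B hB L V₀ _ hT₂).1).fun_mul analyticAt_const))

/-- **(121)** `Q(V₀, A, c) = (1/i) log V̿₁(c)` is analytic: `log V̿₁(c)` (series logarithm (21)) of `V₁ = e^{B(t)}` at the
background `V₀` is analytic in `t` wherever the contour words entering (89) lie in the domain of the logarithm and
`|V̿₁(c) − 1| < 1`.  (The unit `1/i` is immaterial to analyticity.) [cite: Balaban1985Averaging, (121) p.36] -/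
theorem analyticAt_mlog_dbavgCovZ_expCfg (B : E → SiteZ d → Fin d → 𝔸) {t₀ : E}
    (hB : ∀ x κ, AnalyticAt ℂ (fun t => B t x κ) t₀) (L : ℕ) (V₀ : SiteZ d → Fin d → 𝔸ˣ) (q : SiteZ d) (κ : Fin d)
    (hW : ∀ i : IdxZ d L, ‖((WZ L (expCfg (B t₀) * V₀) q κ i : 𝔸ˣ) : 𝔸) - 1‖ < 1)
    (hT₁ : ∀ r : Fin d → Fin L,
      ‖((tHol V₀ (expCfg (B t₀)) q (treeWord (offZ L r)) : 𝔸ˣ) : 𝔸) - 1‖ < 1)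
    (hT₂ : ∀ r : Fin d → Fin L,
      ‖((tHol V₀ (expCfg (B t₀)) (q + (L : ℤ) • e κ) (treeWord (offZ L r)) : 𝔸ˣ) : 𝔸) - 1‖ < 1)
    (hD : ‖((dbavgCovZ L V₀ (expCfg (B t₀)) q κ : 𝔸ˣ) : 𝔸) - 1‖ < 1) :
    AnalyticAt ℂ (fun t => mlog ((dbavgCovZ L V₀ (expCfg (B t)) q κ : 𝔸ˣ) : 𝔸)) t₀ :=
  (ExpMeanLog.analyticAt_mlog hD).fun_comp_of_eq (analyticAt_dbavgCovZ_expCfg B hB L V₀ q κ hW hT₁ hT₂) rfl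

end Analytic

/-! ## §2 The domain conditions from the regularity of `V₀` and the smallness of `A`, for the record loops -/

section Estimates

variable {𝔸 : Type*} [NormedRing 𝔸] [NormedAlgebra ℂ 𝔸] [CompleteSpace 𝔸] [NormOneClass 𝔸]

omit [NormedAlgebra ℂ 𝔸] [CompleteSpace 𝔸] [NormOneClass 𝔸] in
/-- `|XY − 1| ≤ x + y + xy` when `|X − 1| ≤ x`, `|Y − 1| ≤ y` (`XY − 1 = (X − 1)(Y − 1) + (X − 1) + (Y − 1)`). [folklore] -/
private theorem norm_mul_sub_one_le {X Y : 𝔸} {x y : ℝ} (hX : ‖X - 1‖ ≤ x) (hY : ‖Y - 1‖ ≤ y) (hx : 0 ≤ x) :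
    ‖X * Y - 1‖ ≤ x + y + x * y := by
  have h : X * Y - 1 = (X - 1) * (Y - 1) + (X - 1) + (Y - 1) := by noncomm_ring
  rw [h]
  calc ‖(X - 1) * (Y - 1) + (X - 1) + (Y - 1)‖ ≤ ‖(X - 1) * (Y - 1)‖ + ‖X - 1‖ + ‖Y - 1‖ := norm_add₃_le
    _ ≤ ‖X - 1‖ * ‖Y - 1‖ + ‖X - 1‖ + ‖Y - 1‖ := by gcongr; exact norm_mul_le _ _
    _ ≤ x * y + x + y := by gcongr
    _ = x + y + x * y := by ring

omit [NormedAlgebra ℂ 𝔸] [CompleteSpace 𝔸] in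
/-- `|X| ≤ 1 + |X − 1|`. [folklore] -/
private theorem norm_le_one_add_norm_sub_one (X : 𝔸) : ‖X‖ ≤ 1 + ‖X - 1‖ := by
  have h := norm_add_le (X - 1) (1 : 𝔸)
  rw [sub_add_cancel, norm_one] at h
  linarith

omit [NormOneClass 𝔸] in
/-- `|e^{Y} − 1| ≤ 2|Y|` for `|Y| ≤ 1` (`|e^{Y} − 1| ≤ e^{|Y|} − 1` termwise, and `e^{s} − 1 ≤ 2s` on `[0, 1]`,
Mathlib's `Real.abs_exp_sub_one_le`). [folklore] -/
private theorem norm_exp_sub_one_le_two_mul {Y : 𝔸} (h : ‖Y‖ ≤ 1) : ‖exp Y - 1‖ ≤ 2 * ‖Y‖ := by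
  have h1 := (norm_exp_sub_one_le_of_norm_le (le_refl ‖Y‖)).1
  have h2 := Real.abs_exp_sub_one_le (x := ‖Y‖) (by rwa [abs_of_nonneg (norm_nonneg _)])
  rw [abs_of_nonneg (norm_nonneg Y)] at h2
  exact h1.trans ((le_abs_self _).trans h2)

omit [NormOneClass 𝔸] in
/-- `|X_c| ≤ 2w` when every block contour `V(Γ_{c,x})V(c)⁻¹` of the configuration is within `w ≤ 1/2` of `1`
(`|log W| ≤ 2|W − 1|`, and the weights `L^{−d}` average). [cite: Balaban1985Averaging, (42) p.23, (47) p.25] -/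
theorem norm_XZ_le_of_WZ {L : ℕ} (hL : 1 ≤ L) (V : SiteZ d → Fin d → 𝔸ˣ) (q : SiteZ d) (κ : Fin d) {w : ℝ}
    (hw : ∀ i : IdxZ d L, ‖((WZ L V q κ i : 𝔸ˣ) : 𝔸) - 1‖ ≤ w) (hw2 : w ≤ 1 / 2) :
    ‖XZ L V q κ‖ ≤ 2 * w := by
  unfold XZ
  exact norm_avgZ_le L hL _ fun i => (norm_mlog_le_two_mul ((hw i).trans hw2)).trans (by linarith [hw i])

omit [NormOneClass 𝔸] in
/-- `|F(y)| ≤ 2τ` when every twisted tree holonomy `(R_{0,y}V₁)(Γ_{y,x})` is within `τ ≤ 1/2` of `1`.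
[cite: Balaban1985Averaging, (62) p.28, (82) p.30] -/
theorem norm_FcovZ_le_of_tHol {L : ℕ} (hL : 1 ≤ L) (V₀ V₁ : SiteZ d → Fin d → 𝔸ˣ) (y : SiteZ d) {τ : ℝ}
    (hτ : ∀ r : Fin d → Fin L, ‖((tHol V₀ V₁ y (treeWord (offZ L r)) : 𝔸ˣ) : 𝔸) - 1‖ ≤ τ) (hτ2 : τ ≤ 1 / 2) :
    ‖FcovZ L V₀ V₁ y‖ ≤ 2 * τ := by
  unfold FcovZ
  exact norm_avg_le L hL _ fun r => (norm_mlog_le_two_mul ((hτ r).trans hτ2)).trans (by linarith [hτ r])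

omit [NormedAlgebra ℂ 𝔸] [CompleteSpace 𝔸] [NormOneClass 𝔸] in
/-- The block contour of the product splits: `(V₁V₀)(Γ_{c,x})(V₁V₀)(c)⁻¹ = (R_{0,c₋}V₁)(Γ_{c,x} ∪ (−Γ_c)) · V₀(Γ_{c,x})V₀(c)⁻¹`.
[cite: Balaban1985Averaging, (58) p.27, (42) p.23] -/
theorem WZ_mul_eq_tHol_mul (L : ℕ) (V₀ V₁ : SiteZ d → Fin d → 𝔸ˣ) (q : SiteZ d) (κ : Fin d) (i : IdxZ d L) :
    WZ L (V₁ * V₀) q κ i = tHol V₀ V₁ q (loopWord L κ (offZ L i.1) i.2.1 i.2.2) * WZ L V₀ q κ i := by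
  rw [WZ_def, WZ_def, tHol, inv_mul_cancel_right]

omit [NormOneClass 𝔸] in
/-- **(65) rearranged**: `Ṽ₁(c) = e^{X_c(V₁V₀)} · (R_{0,c₋}V₁)(Γ_c) · e^{−X_c(V₀)}` (`Γ_c` the straight contour of the
`L`-bond `c`). [cite: Balaban1985Averaging, (65) p.29, (42) p.23] -/
theorem tildZ_eq_exp_tHol_exp (L : ℕ) (V₀ V₁ : SiteZ d → Fin d → 𝔸ˣ) (q : SiteZ d) (κ : Fin d) :
    tildZ L V₀ V₁ q κ = expUnit (XZ L (V₁ * V₀) q κ) * tHol V₀ V₁ q (seg κ L) * expUnit (-XZ L V₀ q κ) := by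
  simp only [tildZ_apply, bavgZ_apply, tHol, mul_inv_rev, val_inv_expUnit, mul_assoc]

/-- **THE DOMAIN CONDITIONS AT A GENERAL BACKGROUND** (general-`V₀` twin of `B7Prop3Flat.logDomain_of_le_c3`): if
`V₁ = e^{A}` with `(2d+2)L·sup_b|A_b| ≤ θ ≤ 1/64`, and the background `V₀` is unit-bounded with `α`-regular block contours at
the `L`-bond `c = ⟨q, q + Le_κ⟩` (`|V₀(Γ_{c,x})V₀(c)⁻¹ − 1| ≤ α ≤ 1/64`, print's (43)–(44) for the regular class of
Sect. C), then every block contour of `V₁V₀` at `c` is within `1/16` of `1`, every twisted tree holonomy at `c₋`, `c₊` within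
`1/32`, and `|V̿₁(c) − 1| ≤ 4/5`. [cite: Balaban1985Averaging, (120) p.35, (47) p.25, (43) p.24] -/
theorem logDomainCovZ {L : ℕ} (hL : 1 ≤ L) {V₀ : SiteZ d → Fin d → 𝔸ˣ} (hV₀ : ∀ x κ, V₀ x κ ∈ U1 𝔸)
    (A : SiteZ d → Fin d → 𝔸) {a θ α : ℝ} (ha : 0 ≤ a) (hA : ∀ x κ, ‖A x κ‖ ≤ a)
    (hθ : ((2 * (d * L) + L + L : ℕ) : ℝ) * a ≤ θ) (hθ0 : 0 ≤ θ) (hθ1 : θ ≤ 1 / 64)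
    (q : SiteZ d) (κ : Fin d) (hα1 : α ≤ 1 / 64)
    (hreg : ∀ i : IdxZ d L, ‖((WZ L V₀ q κ i : 𝔸ˣ) : 𝔸) - 1‖ ≤ α) :
    (∀ i : IdxZ d L, ‖((WZ L (expCfg A * V₀) q κ i : 𝔸ˣ) : 𝔸) - 1‖ ≤ 1 / 16) ∧
    (∀ r : Fin d → Fin L, ‖((tHol V₀ (expCfg A) q (treeWord (offZ L r)) : 𝔸ˣ) : 𝔸) - 1‖ ≤ 1 / 32) ∧
    (∀ r : Fin d → Fin L,
      ‖((tHol V₀ (expCfg A) (q + (L : ℤ) • e κ) (treeWord (offZ L r)) : 𝔸ˣ) : 𝔸) - 1‖ ≤ 1 / 32) ∧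
    ‖((dbavgCovZ L V₀ (expCfg A) q κ : 𝔸ˣ) : 𝔸) - 1‖ ≤ 4 / 5 := by
  -- every contour entering (89) has length `≤ (2d+2)L`, so its twisted holonomy is within `2θ ≤ 1/32` of `1`
  have hτ : ∀ (w : List (Letter d)) (y : SiteZ d), w.length ≤ 2 * (d * L) + L + L →
      ‖((tHol V₀ (expCfg A) y w : 𝔸ˣ) : 𝔸) - 1‖ ≤ 1 / 32 := fun w y hw =>
    (norm_tHol_expCfg_sub_one_le_of_length hV₀ A ha hA hθ hθ0 hθ1 hw y).trans (by linarith)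
  have htree : ∀ r : Fin d → Fin L, (treeWord (offZ L r)).length ≤ 2 * (d * L) + L + L := fun r => by
    rw [length_treeWord]; have := l1_offZ_le_dL L r; omega
  have hloop : ∀ i : IdxZ d L,
      (loopWord L κ (offZ L i.1) i.2.1 i.2.2).length ≤ 2 * (d * L) + L + L := fun i => by
    rw [length_loopWord]
    have := l1_offZ_le_dL L i.1; omega
  have hseg : (seg κ (L : ℤ) : List (Letter d)).length ≤ 2 * (d * L) + L + L := by
    rw [length_seg, Int.natAbs_natCast]; omega
  have hT₁ : ∀ r : Fin d → Fin L,
      ‖((tHol V₀ (expCfg A) q (treeWord (offZ L r)) : 𝔸ˣ) : 𝔸) - 1‖ ≤ 1 / 32 := fun r => hτ _ _ (htree r)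
  have hT₂ : ∀ r : Fin d → Fin L,
      ‖((tHol V₀ (expCfg A) (q + (L : ℤ) • e κ) (treeWord (offZ L r)) : 𝔸ˣ) : 𝔸) - 1‖ ≤ 1 / 32 :=
    fun r => hτ _ _ (htree r)
  -- block contours of the product: `(1 + 1/32)(1 + α) − 1 ≤ 1/16`
  have hW : ∀ i : IdxZ d L, ‖((WZ L (expCfg A * V₀) q κ i : 𝔸ˣ) : 𝔸) - 1‖ ≤ 1 / 16 := by
    intro i
    rw [WZ_mul_eq_tHol_mul, Units.val_mul]
    refine (norm_mul_sub_one_le (hτ _ _ (hloop i)) (hreg i) (by norm_num)).trans ?_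
    nlinarith
  refine ⟨hW, hT₁, hT₂, ?_⟩
  -- the exponents `X_c(V₁V₀)`, `X_c(V₀)` and the frames
  have hX' : ‖XZ L (expCfg A * V₀) q κ‖ ≤ 1 / 8 :=
    (norm_XZ_le_of_WZ hL _ q κ hW (by norm_num)).trans (by norm_num)
  have hX₀ : ‖XZ L V₀ q κ‖ ≤ 1 / 32 := (norm_XZ_le_of_WZ hL _ q κ hreg (by linarith)).trans (by linarith)
  have hE' : ‖exp (XZ L (expCfg A * V₀) q κ) - 1‖ ≤ 1 / 4 :=
    (norm_exp_sub_one_le_two_mul (hX'.trans (by norm_num))).trans (by linarith)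
  have hE₀ : ‖exp (XZ L V₀ q κ) - 1‖ ≤ 1 / 16 :=
    (norm_exp_sub_one_le_two_mul (hX₀.trans (by norm_num))).trans (by linarith)
  have hE₀' : ‖exp (-XZ L V₀ q κ) - 1‖ ≤ 1 / 16 :=
    (norm_exp_sub_one_le_two_mul ((norm_neg _).le.trans (hX₀.trans (by norm_num)))).trans
      (by rw [norm_neg]; linarith)
  have hF : ∀ y : SiteZ d, (∀ r : Fin d → Fin L,
      ‖((tHol V₀ (expCfg A) y (treeWord (offZ L r)) : 𝔸ˣ) : 𝔸) - 1‖ ≤ 1 / 32) →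
      ‖((wframeZ L V₀ (expCfg A) y : 𝔸ˣ) : 𝔸) - 1‖ ≤ 1 / 8 ∧
        ‖(((wframeZ L V₀ (expCfg A) y)⁻¹ : 𝔸ˣ) : 𝔸) - 1‖ ≤ 1 / 8 := by
    intro y hy
    have hFy : ‖FcovZ L V₀ (expCfg A) y‖ ≤ 1 / 16 :=
      (norm_FcovZ_le_of_tHol hL V₀ _ y hy (by norm_num)).trans (by norm_num)
    refine ⟨?_, ?_⟩
    · rw [wframeZ, val_expUnit]
      exact (norm_exp_sub_one_le_two_mul (hFy.trans (by norm_num))).trans (by linarith)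
    · rw [wframeZ, val_inv_expUnit, val_expUnit]
      exact (norm_exp_sub_one_le_two_mul ((norm_neg _).le.trans (hFy.trans (by norm_num)))).trans
        (by rw [norm_neg]; linarith)
  -- `Ṽ₁(c) = e^{X'}·t·e^{−X₀}` is within `3/8` of `1`
  have htild : ‖((tildZ L V₀ (expCfg A) q κ : 𝔸ˣ) : 𝔸) - 1‖ ≤ 3 / 8 := by
    rw [tildZ_eq_exp_tHol_exp, Units.val_mul, Units.val_mul, val_expUnit, val_expUnit]
    have h1 := norm_mul_sub_one_le hE' (hτ _ q hseg) (by norm_num)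
    refine (norm_mul_sub_one_le h1 hE₀' (by norm_num)).trans ?_
    norm_num
  -- the rotated frame `R̄_{0,c} w(c₊) = V̄₀(c)·w(c₊)·V̄₀(c)⁻¹` is within `1/7` of `1`
  have hb₀ : ‖((bavgZ L V₀ q κ : 𝔸ˣ) : 𝔸)‖ ≤ 17 / 16 := by
    rw [bavgZ_apply, Units.val_mul, val_expUnit]
    refine (norm_mul_le _ _).trans ?_
    have h1 := norm_le_one_add_norm_sub_one (exp (XZ L V₀ q κ))
    have h2 := (mem_U1.1 (hol_mem hV₀ q (seg κ (L : ℤ)))).1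
    nlinarith [norm_nonneg (exp (XZ L V₀ q κ)), norm_nonneg (((hol V₀ q (seg κ (L : ℤ))) : 𝔸ˣ) : 𝔸)]
  have hb₀' : ‖(((bavgZ L V₀ q κ)⁻¹ : 𝔸ˣ) : 𝔸)‖ ≤ 17 / 16 := by
    have hv : (((bavgZ L V₀ q κ)⁻¹ : 𝔸ˣ) : 𝔸) = (((hol V₀ q (seg κ L))⁻¹ : 𝔸ˣ) : 𝔸) * exp (-XZ L V₀ q κ) := by
      simp only [bavgZ_apply, mul_inv_rev, val_inv_expUnit, Units.val_mul, val_expUnit]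
    rw [hv]
    refine (norm_mul_le _ _).trans ?_
    have h1 := norm_le_one_add_norm_sub_one (exp (-XZ L V₀ q κ))
    have h2 := (mem_U1.1 (hol_mem hV₀ q (seg κ (L : ℤ)))).2
    nlinarith [norm_nonneg (exp (-XZ L V₀ q κ)), norm_nonneg ((((hol V₀ q (seg κ (L : ℤ))))⁻¹ : 𝔸ˣ) : 𝔸)]
  have hZ : ‖((bavgZ L V₀ q κ : 𝔸ˣ) : 𝔸) * ((wframeZ L V₀ (expCfg A) (q + (L : ℤ) • e κ) : 𝔸ˣ) : 𝔸)
      * (((bavgZ L V₀ q κ)⁻¹ : 𝔸ˣ) : 𝔸) - 1‖ ≤ 1 / 7 := by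
    have hw := (hF _ hT₂).1
    have he : ((bavgZ L V₀ q κ : 𝔸ˣ) : 𝔸) * ((wframeZ L V₀ (expCfg A) (q + (L : ℤ) • e κ) : 𝔸ˣ) : 𝔸)
        * (((bavgZ L V₀ q κ)⁻¹ : 𝔸ˣ) : 𝔸) - 1
        = ((bavgZ L V₀ q κ : 𝔸ˣ) : 𝔸) * (((wframeZ L V₀ (expCfg A) (q + (L : ℤ) • e κ) : 𝔸ˣ) : 𝔸) - 1)
          * (((bavgZ L V₀ q κ)⁻¹ : 𝔸ˣ) : 𝔸) := by
      rw [mul_sub, sub_mul, mul_one, Units.mul_inv]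
    rw [he]
    refine (norm_mul_le _ _).trans ((mul_le_mul (norm_mul_le _ _) hb₀' (norm_nonneg _)
      (mul_nonneg (norm_nonneg _) (norm_nonneg _))).trans ?_)
    nlinarith [norm_nonneg ((bavgZ L V₀ q κ : 𝔸ˣ) : 𝔸),
      norm_nonneg (((wframeZ L V₀ (expCfg A) (q + (L : ℤ) • e κ) : 𝔸ˣ) : 𝔸) - 1), mul_le_mul hb₀ hw (norm_nonneg _) (by norm_num)]
  -- assemble (89): `V̿₁(c) = w(c₋)⁻¹ · Ṽ₁(c) · R̄_{0,c} w(c₊)`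
  rw [dbavgCovZ_apply, Units.val_mul, Units.val_mul, Rc_apply, Units.val_mul, Units.val_mul]
  have h1 := norm_mul_sub_one_le (hF q hT₁).2 htild (by norm_num)
  refine (norm_mul_sub_one_le h1 hZ (by norm_num)).trans ?_
  norm_num

/-- … in particular all four are `< 1`: the contour words entering (89) and `V̿₁(c)` itself lie in the domain of the
series logarithm (21). [cite: Balaban1985Averaging, (120)–(121) pp.35–36] -/
theorem logDomainCovZ_lt {L : ℕ} (hL : 1 ≤ L) {V₀ : SiteZ d → Fin d → 𝔸ˣ} (hV₀ : ∀ x κ, V₀ x κ ∈ U1 𝔸)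
    (A : SiteZ d → Fin d → 𝔸) {a θ α : ℝ} (ha : 0 ≤ a) (hA : ∀ x κ, ‖A x κ‖ ≤ a)
    (hθ : ((2 * (d * L) + L + L : ℕ) : ℝ) * a ≤ θ) (hθ0 : 0 ≤ θ) (hθ1 : θ ≤ 1 / 64)
    (q : SiteZ d) (κ : Fin d) (hα1 : α ≤ 1 / 64)
    (hreg : ∀ i : IdxZ d L, ‖((WZ L V₀ q κ i : 𝔸ˣ) : 𝔸) - 1‖ ≤ α) :
    (∀ i : IdxZ d L, ‖((WZ L (expCfg A * V₀) q κ i : 𝔸ˣ) : 𝔸) - 1‖ < 1) ∧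
    (∀ r : Fin d → Fin L, ‖((tHol V₀ (expCfg A) q (treeWord (offZ L r)) : 𝔸ˣ) : 𝔸) - 1‖ < 1) ∧
    (∀ r : Fin d → Fin L,
      ‖((tHol V₀ (expCfg A) (q + (L : ℤ) • e κ) (treeWord (offZ L r)) : 𝔸ˣ) : 𝔸) - 1‖ < 1) ∧
    ‖((dbavgCovZ L V₀ (expCfg A) q κ : 𝔸ˣ) : 𝔸) - 1‖ < 1 := by
  obtain ⟨hW, hT₁, hT₂, hD⟩ := logDomainCovZ hL hV₀ A ha hA hθ hθ0 hθ1 q κ hα1 hreg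
  exact ⟨fun r => (hW r).trans_lt (by norm_num), fun r => (hT₁ r).trans_lt (by norm_num),
    fun r => (hT₂ r).trans_lt (by norm_num), hD.trans_lt (by norm_num)⟩

/-- **`Q(V₀, A, c)` IS BOUNDED ON ITS DOMAIN**: `|log V̿₁(c)| ≤ 4` there (`|log W| ≤ |W − 1|/(1 − |W − 1|)` with
`|V̿₁(c) − 1| ≤ 4/5`) — the bound the Cauchy estimate for the second-order remainder (123) consumes.
[cite: Balaban1985Averaging, (121)–(123) p.36] -/
theorem norm_mlog_dbavgCovZ_le {L : ℕ} (hL : 1 ≤ L) {V₀ : SiteZ d → Fin d → 𝔸ˣ} (hV₀ : ∀ x κ, V₀ x κ ∈ U1 𝔸)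
    (A : SiteZ d → Fin d → 𝔸) {a θ α : ℝ} (ha : 0 ≤ a) (hA : ∀ x κ, ‖A x κ‖ ≤ a)
    (hθ : ((2 * (d * L) + L + L : ℕ) : ℝ) * a ≤ θ) (hθ0 : 0 ≤ θ) (hθ1 : θ ≤ 1 / 64)
    (q : SiteZ d) (κ : Fin d) (hα1 : α ≤ 1 / 64)
    (hreg : ∀ i : IdxZ d L, ‖((WZ L V₀ q κ i : 𝔸ˣ) : 𝔸) - 1‖ ≤ α) :
    ‖mlog ((dbavgCovZ L V₀ (expCfg A) q κ : 𝔸ˣ) : 𝔸)‖ ≤ 4 := by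
  have hD := (logDomainCovZ hL hV₀ A ha hA hθ hθ0 hθ1 q κ hα1 hreg).2.2.2
  refine (norm_mlog_le_div (hD.trans_lt (by norm_num))).trans ?_
  rw [div_le_iff₀ (by linarith)]
  linarith

end Estimates

/-! ## §3 Proposition 3, the analyticity clause (121), for the record -/

section Prop3

variable {𝔸 : Type*} [NormedRing 𝔸] [NormedAlgebra ℂ 𝔸] [CompleteSpace 𝔸] [NormOneClass 𝔸]
variable {E : Type*} [NormedAddCommGroup E] [NormedSpace ℂ E]

/-- **PROPOSITION 3, THE ANALYTICITY CLAUSE (121) AT A GENERAL BACKGROUND**: "Q(V₀, A, c) = (1/i) log (V̿₁)_c […] is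
an analytic function of A […] for |A_b| < c₃(d, L)" — for a unit-bounded background `V₀` with `α`-regular block contours
at `c` (`α ≤ 1/64`) and a field `B(t)` depending analytically on a parameter `t`, with `(2d+2)L·sup_b|B(t₀)_b| ≤ θ ≤ 1/64`
(so `c₃(d, L) = 1/(128(d+1)L)` = `B7Prop3Flat.c3` will do), `t ↦ log V̿₁(c)[e^{B(t)}]` is analytic at `t₀`.  The
parametrised shape is the one the `k`-fold composition (63)/(128) consumes (`B7Prop3Flat.prop3_flat_analyticAt` is the case
`V₀ = 1`). [cite: Balaban1985Averaging, Proposition 3 (121) p.36] -/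
theorem prop3Z_general_analyticAt (B : E → SiteZ d → Fin d → 𝔸) {t₀ : E}
    (hB : ∀ x κ, AnalyticAt ℂ (fun t => B t x κ) t₀) {L : ℕ} (hL : 1 ≤ L)
    {V₀ : SiteZ d → Fin d → 𝔸ˣ} (hV₀ : ∀ x κ, V₀ x κ ∈ U1 𝔸) {a θ α : ℝ} (ha : 0 ≤ a)
    (hA : ∀ x κ, ‖B t₀ x κ‖ ≤ a) (hθ : ((2 * (d * L) + L + L : ℕ) : ℝ) * a ≤ θ) (hθ0 : 0 ≤ θ) (hθ1 : θ ≤ 1 / 64)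
    (q : SiteZ d) (κ : Fin d) (hα1 : α ≤ 1 / 64)
    (hreg : ∀ i : IdxZ d L, ‖((WZ L V₀ q κ i : 𝔸ˣ) : 𝔸) - 1‖ ≤ α) :
    AnalyticAt ℂ (fun t => mlog ((dbavgCovZ L V₀ (expCfg (B t)) q κ : 𝔸ˣ) : 𝔸)) t₀ := by
  obtain ⟨hW, hT₁, hT₂, hD⟩ := logDomainCovZ_lt hL hV₀ (B t₀) ha hA hθ hθ0 hθ1 q κ hα1 hreg
  exact analyticAt_mlog_dbavgCovZ_expCfg B hB L V₀ q κ hW hT₁ hT₂ hD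

/-- The same under print's threshold `|A_b| ≤ a ≤ c₃(d, L)`, `c₃ = B7Prop3Flat.c3 d L = 1/(128(d+1)L)`.
[cite: Balaban1985Averaging, Proposition 3 (121) p.36] -/
theorem prop3Z_general_analyticAt_of_le_c3 (B : E → SiteZ d → Fin d → 𝔸) {t₀ : E}
    (hB : ∀ x κ, AnalyticAt ℂ (fun t => B t x κ) t₀) {L : ℕ} (hL : 1 ≤ L)
    {V₀ : SiteZ d → Fin d → 𝔸ˣ} (hV₀ : ∀ x κ, V₀ x κ ∈ U1 𝔸) {a α : ℝ} (ha : 0 ≤ a)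
    (hA : ∀ x κ, ‖B t₀ x κ‖ ≤ a) (hac : a ≤ c3 d L)
    (q : SiteZ d) (κ : Fin d) (hα1 : α ≤ 1 / 64)
    (hreg : ∀ i : IdxZ d L, ‖((WZ L V₀ q κ i : 𝔸ˣ) : 𝔸) - 1‖ ≤ α) :
    AnalyticAt ℂ (fun t => mlog ((dbavgCovZ L V₀ (expCfg (B t)) q κ : 𝔸ˣ) : 𝔸)) t₀ := by
  have hL1 : (1 : ℝ) ≤ L := by exact_mod_cast hL
  have hcast : ((2 * (d * L) + L + L : ℕ) : ℝ) = 2 * ((d : ℝ) + 1) * L := by push_cast; ring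
  refine prop3Z_general_analyticAt B hB hL hV₀ ha hA (θ := ((2 * (d * L) + L + L : ℕ) : ℝ) * a) le_rfl
    (by positivity) ?_ q κ hα1 hreg
  rw [hcast]
  have hpos : (0 : ℝ) < 128 * ((d : ℝ) + 1) * L := by positivity
  have h1 : a * (128 * ((d : ℝ) + 1) * L) ≤ 1 := by
    have := mul_le_mul_of_nonneg_right hac hpos.le
    rwa [c3, one_div, inv_mul_cancel₀ hpos.ne'] at this
  nlinarith

end Prop3

end Literature.MathematicalPhysics.QuantumFieldTheory.Balaban1983to89.B7Prop3GeneralAnalyticRec
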